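import Summits.CriticalPhenomena.SAWScalingLimit.Theses.SAWReversalUpgrade
import Summits.CriticalPhenomena.SAWScalingLimit.Theorems.SAWReversalUpgradeNoDeepReturnPolylineToVertex
import Summits.CriticalPhenomena.SAWScalingLimit.Theorems.SAWReversalUpgradeNoDeepReturnLawReverseEvent
import Summits.CriticalPhenomena.SAWScalingLimit.Theorems.SAWReversalUpgradeNoDeepReturnFirstEntranceFarBound
import HarnessLib

/-!
# Line `naked-root-localisation` (SketchIdeator2) for the crux `SAWReversalUpgrade.NoDeepReturn`
(item stmt-CriticalPhenomena-18004, route SAWReversalUpgrade, rank 3) — lead's working skeleton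

The crux: for every Dobrushin domain `(D; a, b)` and endpoint approximation, for every `ε, η > 0`
there is `r > 0` such that for all small `δ` the critical SAW law gives mass `≤ η` to walks whose
polyline is `ε`-far from `a = D.pt 0` at some time and `r`-close to `a` at a later time.

Composition (lever of the idea card `naked-root-localisation`): polyline event ⇒ vertex event
(`stub_polylineToVertex`); split the close vertex by the STOLZ-REACHABILITY predicate
`∃ p : Walk y a_δ, ∀ w ∈ p.support, dist(δw, a) ≤ ρ ∧ κ·dist(δw, δa_δ) ≤ infDist(δw, Dᶜ)`;
the non-Stolz part is the residual `stub_collarReturnAvoidance`; the Stolz part is, after exact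
time reversal (`stub_lawReverseEvent`, `lawAt_map_sawReverse`), the event of the generic
first-entrance far bound `stub_firstEntranceFarBound` for the reversed walk `b_δ → a_δ` with
entrance predicate `A :=` Stolz-reachability, whose hypothesis is the atom `stub_rootLocalisation`.

Stubs (all statements written in TREE VOCABULARY ONLY, so that each lands as its own Theorems file):

* `stub_polylineToVertex` — polyline `(ε, r)` event ⇒ vertex `(ε, r + δ)` event — LANDED p158730;
* `stub_lawReverseEvent` — `law(u→v){P at i, Q at j > i} = law(v→u){Q at i, P at j > i}` — LANDED p158698;
* `stub_firstEntranceFarBound` — the (★)-engine: first-entrance decomposition + inclusion — LANDED p159214;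
* `stub_rootLocalisation` — THE ATOM (open): far mass `≤ η ×` Stolz-confined mass — STUCK (its
  lattice-local regime is the tail of the rooted critical census, 7117 class, open on ℤ²);
* `stub_collarReturnAvoidance` — THE RESIDUAL (open; a sub-event of the crux, kernel-checked
  `collarReturnAvoidance_of_noDeepReturn` p159051; equal to the crux's vertex event minus a
  vanishing root neighbourhood on outward-cusp germs at `a`, so crux-sized).

`NoDeepReturn_proof` concludes the crux BY NAME; it is a real proof (filter bookkeeping, union
bound, `ENNReal.ofReal (η/2) + ENNReal.ofReal (η/2) = ENNReal.ofReal η`) modulo the two open stubs.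
Status 2026-08-17 (lead, cycle 1): line declared dead — see `Lines/SketchIdeator2.dead.md`.
-/

noncomputable section

namespace Summit.CriticalPhenomena.SAWScalingLimit.Theorems.NoDeepReturn.NakedRoot

open MeasureTheory Filter Topology Set Metric
open scoped ENNReal
open Literature.Probability.LatticeModels (Site meshPoint discreteDomainGraph)
open Literature.Probability.RandomPlanarGeometry
open Literature.Probability.RandomPlanarGeometry.SAW

/-! ## The five stubs (registered; `sorry` only in the ones not yet landed) -/

/-! Stub 1 `stub_polylineToVertex` — LANDED (p158730,
`Theorems/SAWReversalUpgradeNoDeepReturnPolylineToVertex.lean`), imported.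
Stub 2 `stub_lawReverseEvent` — LANDED (p158698,
`Theorems/SAWReversalUpgradeNoDeepReturnLawReverseEvent.lean`), imported. -/

/-! Stub 3 `stub_firstEntranceFarBound` — LANDED (p159214,
`Theorems/SAWReversalUpgradeNoDeepReturnFirstEntranceFarBound.lean`), imported. -/

/-- **Stub 4 — THE ATOM `RootLocalisation` (open research bet of the line).** For every Dobrushin
domain and root approximation `δ·a_δ → a = D.pt 0`, every `κ ∈ (0,1)` and `ε, η > 0` there is
`r₀ > 0` such that for every `ρ ∈ (0, r₀]`, all small `δ` and every vertex `y` that is joined to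
`a_δ` by a lattice walk of `D_δ` through STOLZ vertices of the `ρ`-ball (within `ρ` of `a`, with
clearance from `∂D` at least `κ ×` the distance to `δ·a_δ`), the `x_c`-mass of the SAWs of `D_δ`
from `y` to `a_δ` that visit a vertex `ε`-far from `a` is at most `η` times the mass of those all
of whose vertices are Stolz-joined to `a_δ`. One boundary point, one two-point ensemble; no `b`,
no past, no chordal normalisation. Predicted ratio `≍ (ρ/ε)^c`; NOT in print on `ℤ²`. -/
theorem stub_rootLocalisation :
    ∀ (D : DobrushinDomain) (a : ℝ → Site 2),
      Tendsto (fun δ => meshPoint δ (a δ)) (𝓝[>] (0 : ℝ)) (𝓝 (D.pt 0)) →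
      ∀ κ : ℝ, 0 < κ → κ < 1 → ∀ ε : ℝ, 0 < ε → ∀ η : ℝ, 0 < η → ∃ r₀ : ℝ, 0 < r₀ ∧
        ∀ ρ : ℝ, 0 < ρ → ρ ≤ r₀ → ∀ᶠ δ in 𝓝[>] (0 : ℝ), ∀ y : Site 2,
          (∃ p : (discreteDomainGraph D.carrier δ).Walk y (a δ), ∀ w ∈ p.support,
            dist (meshPoint δ w) (D.pt 0) ≤ ρ ∧
              κ * dist (meshPoint δ w) (meshPoint δ (a δ)) ≤ infDist (meshPoint δ w) D.carrierᶜ) →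
          weight D.carrier δ y (a δ)
              {γ | ∃ j ≤ γ.walk.length, ε ≤ dist (meshPoint δ (γ.walk.getVert j)) (D.pt 0)} ≤
            ENNReal.ofReal η *
              weight D.carrier δ y (a δ) {γ | ∀ j ≤ γ.walk.length,
                ∃ p : (discreteDomainGraph D.carrier δ).Walk (γ.walk.getVert j) (a δ),
                  ∀ w ∈ p.support, dist (meshPoint δ w) (D.pt 0) ≤ ρ ∧
                    κ * dist (meshPoint δ w) (meshPoint δ (a δ)) ≤
                      infDist (meshPoint δ w) D.carrierᶜ} := by
  sorry

/-- **Stub 5 — THE RESIDUAL `CollarReturnAvoidance` (open; a sub-event of the crux).** Deep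
returns that LAND OUTSIDE the Stolz-reachable set — in the boundary collar of relative width `κ`
at `a`, or in a pocket not Stolz-joined to `a_δ` — have small probability once `κ` is small: for
all `ε, η > 0` there are `κ ∈ (0,1)` and `r₀ > 0` with, for every `ρ ∈ (0, r₀]` and all small `δ`,
law `≤ η` of "some vertex `ε`-far from `a`, a LATER vertex `ρ`-close to `a` and not Stolz-joined
to `a_δ`". -/
theorem stub_collarReturnAvoidance :
    ∀ (D : DobrushinDomain) (a b : ℝ → Site 2), IsEndpointApprox D a b →
      ∀ ε : ℝ, 0 < ε → ∀ η : ℝ, 0 < η → ∃ κ : ℝ, 0 < κ ∧ κ < 1 ∧ ∃ r₀ : ℝ, 0 < r₀ ∧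
        ∀ ρ : ℝ, 0 < ρ → ρ ≤ r₀ → ∀ᶠ δ in 𝓝[>] (0 : ℝ),
          law D.carrier δ (a δ) (b δ) {γ | ∃ i j : ℕ, i < j ∧ j ≤ γ.walk.length ∧
            ε ≤ dist (meshPoint δ (γ.walk.getVert i)) (D.pt 0) ∧
            dist (meshPoint δ (γ.walk.getVert j)) (D.pt 0) ≤ ρ ∧
            ¬ ∃ p : (discreteDomainGraph D.carrier δ).Walk (γ.walk.getVert j) (a δ),
                ∀ w ∈ p.support, dist (meshPoint δ w) (D.pt 0) ≤ ρ ∧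
                  κ * dist (meshPoint δ w) (meshPoint δ (a δ)) ≤
                    infDist (meshPoint δ w) D.carrierᶜ} ≤ ENNReal.ofReal η := by
  sorry

/-! ## Glue (proved) -/

/-- The root vertex is Stolz-joined to itself as soon as it is `ρ`-close to `a` (nil walk). -/
theorem stolzReach_root {D : DobrushinDomain} {δ : ℝ} {a₀ : Site 2} {κ ρ : ℝ}
    (h : dist (meshPoint δ a₀) (D.pt 0) ≤ ρ) :
    ∃ p : (discreteDomainGraph D.carrier δ).Walk a₀ a₀, ∀ w ∈ p.support,
      dist (meshPoint δ w) (D.pt 0) ≤ ρ ∧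
        κ * dist (meshPoint δ w) (meshPoint δ a₀) ≤ infDist (meshPoint δ w) D.carrierᶜ := by
  refine ⟨SimpleGraph.Walk.nil, fun w hw => ?_⟩
  rw [SimpleGraph.Walk.support_nil, List.mem_singleton] at hw
  subst hw
  refine ⟨h, ?_⟩
  rw [dist_self, mul_zero]
  exact infDist_nonneg

/-- `ENNReal.ofReal (η/2) + ENNReal.ofReal (η/2) = ENNReal.ofReal η` for `η ≥ 0`. -/
theorem ofReal_half_add_half {η : ℝ} (hη : 0 ≤ η) :
    ENNReal.ofReal (η / 2) + ENNReal.ofReal (η / 2) = ENNReal.ofReal η := by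
  rw [← ENNReal.ofReal_add (by positivity) (by positivity), add_halves]

/-- **The crux BY NAME from the five stubs.** Given `ε, η`: `κ, r₁` from the residual (`ε, η/2`),
`r₂` from the atom (`κ, ε, η/2`), `ρ := min (min r₁ r₂) (ε/2)`, `r := ρ/2`; for
`0 < δ < ρ/2` with `dist(δa_δ, a) ≤ ρ`: polyline event ⊆ vertex event (`r + δ ≤ ρ`, `r + δ < ε`);
split the close vertex by Stolz reachability; the Stolz part is reversed into the first-entrance
event for `b_δ → a_δ` with `A :=` Stolz reachability (`A a_δ` by the nil walk) and bounded by the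
(★)-engine fed with the atom; the other part is the residual; union bound. -/
theorem NoDeepReturn_proof :
    Summit.CriticalPhenomena.SAWScalingLimit.Theses.SAWReversalUpgrade.NoDeepReturn := by
  intro D a b hab ε hε η hη
  -- the residual: κ and r₁
  obtain ⟨κ, hκ0, hκ1, r₁, hr₁, hcol⟩ := stub_collarReturnAvoidance D a b hab ε hε (η / 2) (half_pos hη)
  -- the atom: r₂
  obtain ⟨r₂, hr₂, hloc⟩ :=
    stub_rootLocalisation D a hab.tendsto_fst κ hκ0 hκ1 ε hε (η / 2) (half_pos hη)
  set ρ : ℝ := min (min r₁ r₂) (ε / 2) with hρdef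
  have hρ0 : 0 < ρ := lt_min (lt_min hr₁ hr₂) (half_pos hε)
  have hρ1 : ρ ≤ r₁ := (min_le_left _ _).trans (min_le_left _ _)
  have hρ2 : ρ ≤ r₂ := (min_le_left _ _).trans (min_le_right _ _)
  have hρε : ρ ≤ ε / 2 := min_le_right _ _
  refine ⟨ρ / 2, half_pos hρ0, ?_⟩
  have hcolρ := hcol ρ hρ0 hρ1
  have hlocρ := hloc ρ hρ0 hρ2
  have hpos : ∀ᶠ δ in 𝓝[>] (0 : ℝ), (0 : ℝ) < δ := self_mem_nhdsWithin
  have hsmall : ∀ᶠ δ in 𝓝[>] (0 : ℝ), δ < ρ / 2 := nhdsWithin_le_nhds (Iio_mem_nhds (half_pos hρ0))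
  have hroot : ∀ᶠ δ in 𝓝[>] (0 : ℝ), dist (meshPoint δ (a δ)) (D.pt 0) ≤ ρ :=
    (Metric.tendsto_nhds.1 hab.tendsto_fst ρ hρ0).mono fun δ hδ => hδ.le
  filter_upwards [hcolρ, hlocρ, hpos, hsmall, hroot] with δ h1 h2 hδ0 hδρ hδa
  -- names for the three vertex events
  set Far : Site 2 → Prop := fun w => ε ≤ dist (meshPoint δ w) (D.pt 0) with hFar
  set St : Site 2 → Prop := fun w => ∃ p : (discreteDomainGraph D.carrier δ).Walk w (a δ),
      ∀ w' ∈ p.support, dist (meshPoint δ w') (D.pt 0) ≤ ρ ∧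
        κ * dist (meshPoint δ w') (meshPoint δ (a δ)) ≤ infDist (meshPoint δ w') D.carrierᶜ with hSt
  set Vst : Set (DomainSAW D.carrier δ (a δ) (b δ)) :=
    {γ | ∃ i j : ℕ, i < j ∧ j ≤ γ.walk.length ∧ Far (γ.walk.getVert i) ∧ St (γ.walk.getVert j)}
    with hVst
  set Vcol : Set (DomainSAW D.carrier δ (a δ) (b δ)) :=
    {γ | ∃ i j : ℕ, i < j ∧ j ≤ γ.walk.length ∧
      ε ≤ dist (meshPoint δ (γ.walk.getVert i)) (D.pt 0) ∧
      dist (meshPoint δ (γ.walk.getVert j)) (D.pt 0) ≤ ρ ∧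
      ¬ ∃ p : (discreteDomainGraph D.carrier δ).Walk (γ.walk.getVert j) (a δ),
          ∀ w ∈ p.support, dist (meshPoint δ w) (D.pt 0) ≤ ρ ∧
            κ * dist (meshPoint δ w) (meshPoint δ (a δ)) ≤ infDist (meshPoint δ w) D.carrierᶜ}
    with hVcol
  -- polyline event ⊆ Vst ∪ Vcol
  have hsub : {γ : DomainSAW D.carrier δ (a δ) (b δ) | ∃ s t : unitInterval, s < t ∧
      ε ≤ dist (γ.walk.toCurve (meshPoint δ) s) (D.pt 0) ∧
      dist (γ.walk.toCurve (meshPoint δ) t) (D.pt 0) ≤ ρ / 2} ⊆ Vst ∪ Vcol := by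
    intro γ hγ
    obtain ⟨i, j, hij, hj, hfar, hnear⟩ :=
      stub_polylineToVertex D.carrier δ (a δ) (b δ) γ (D.pt 0) ε (ρ / 2) hδ0 (by linarith) hγ
    have hnear' : dist (meshPoint δ (γ.walk.getVert j)) (D.pt 0) ≤ ρ := by linarith
    by_cases hst : St (γ.walk.getVert j)
    · exact Or.inl ⟨i, j, hij, hj, hfar, hst⟩
    · exact Or.inr ⟨i, j, hij, hj, hfar, hnear', hst⟩
  -- the Stolz part, reversed, is the first-entrance event for `b_δ → a_δ`
  have hst_le : law D.carrier δ (a δ) (b δ) Vst ≤ ENNReal.ofReal (η / 2) := by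
    have hrev := stub_lawReverseEvent D.carrier δ (a δ) (b δ) Far St
    rw [hVst, hrev]
    refine stub_firstEntranceFarBound D.carrier D.isBounded δ hδ0 (b δ) (a δ) St (D.pt 0) ε
      (η / 2) (half_pos hη).le (stolzReach_root hδa) ?_
    intro y hy
    exact h2 y hy
  -- the collar part is the residual
  have hcol_le : law D.carrier δ (a δ) (b δ) Vcol ≤ ENNReal.ofReal (η / 2) := h1
  calc law D.carrier δ (a δ) (b δ) {γ | ∃ s t : unitInterval, s < t ∧
          ε ≤ dist (γ.walk.toCurve (meshPoint δ) s) (D.pt 0) ∧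
          dist (γ.walk.toCurve (meshPoint δ) t) (D.pt 0) ≤ ρ / 2}
      ≤ law D.carrier δ (a δ) (b δ) (Vst ∪ Vcol) := measure_mono hsub
    _ ≤ law D.carrier δ (a δ) (b δ) Vst + law D.carrier δ (a δ) (b δ) Vcol := measure_union_le _ _
    _ ≤ ENNReal.ofReal (η / 2) + ENNReal.ofReal (η / 2) := add_le_add hst_le hcol_le
    _ = ENNReal.ofReal η := ofReal_half_add_half hη.le

end Summit.CriticalPhenomena.SAWScalingLimit.Theorems.NoDeepReturn.NakedRoot

end
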